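import Summits.ABC.FunctionField.TransferSheetLadder
import Literature.NumberTheory.EllipticCurves.SzpiroSixFifthsProofs
import Literature.Barriers.ABC.BakerMethodBounds
import HarnessLib

/-!
# Cell abc-ff — transfer sheet: from POLY-SZPIRO to POLY-abc (Oesterlé's `6/5` step with a general
# exponent) and to the ladder's Baker-shape currency `BakerShapeBound 0 1`

`Summits/ABC/FunctionField/TransferSheetOesterle.lean` — theorems only (typ-1). The sheet's two A-PS
currencies are `PolySzpiroWith K` (`log|Δ_min| ≤ K log N + C`, all `E/ℚ`) and `PolyAbcWith M`
(`c ≤ C rad(abc)^M`, all abc triples); the ladder director asked (SHEET F29) for the bridge to the A1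
cell's shape `Literature.Barriers.ABC.BakerShapeBound 0 1` (`log c ≤ κ log rad`). Using the tree's
PROVED packaging of Oesterlé 1988 §2 (Remarque de Szpiro) — `exists_minimal_isog_model`: every abc
triple carries a global minimal model `W₀/ℤ` of a `2`-quotient of its Frey curve with
`N ∣ 2¹² rad(abc)` and `c⁵ ≤ 2⁹ |Δ(W₀)|` — we prove, with the exponent as a PARAMETER:
* `polyAbcWith_of_polySzpiroWith` — `PolySzpiroWith K ⟹ PolyAbcWith (K/5)` for `K ≥ 0`
  (at `K = 6 + ε` this is Oesterlé's «Szpiro ⟹ abc with `6/5 + ε`», tree `abc_sixFifths_of_szpiro_holds`);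
* `polyAbcWith_of_rksPolar'` — row CF-2 in the abc currency by the kernel alone:
  `R_KSλ ⟹ PolyAbcWith ((6 + λ)/5)` (the sharper paper value `1 + λ/6 + ε` through `|c₄|³` and
  `genPolySzpiroWith_of_rksPolar` is recorded in `TransferSheetStrength.lean`, its last Frey-curve step
  is not in the kernel);
* `bakerShapeBound_zero_one_of_polyAbcWith`, `bakerShapeBound_zero_one_of_polySzpiroRat` — F29:
  `Summit.ABC.PolySzpiroRat ⟹ BakerShapeBound 0 1` (polynomial Baker shape), via `rad(abc) ≥ 2`.
HONESTY: abc is not proved by any of this; A-PS / POLY-abc(M) are NOT abc (D-0139); these are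
exponent-bookkeeping theorems between open requirement shapes.
-/

noncomputable section

open WeierstrassCurve IsDedekindDomain
open Literature.NumberTheory.EllipticCurves Literature.NumberTheory.DiophantineGeometry
open Literature.Barriers.ABC

namespace Summit.ABC.FunctionField

/-- Monotonicity of the POLY-SZPIRO shape in the exponent (`log N ≥ 0`). [folklore] -/
theorem polySzpiroWith_mono {K K' : ℝ} (hKK' : K ≤ K') (h : PolySzpiroWith K) : PolySzpiroWith K' := by
  obtain ⟨C, hC⟩ := h
  refine ⟨C, fun W _ => ?_⟩
  have hN1 : (1 : ℝ) ≤ (W.conductorNorm ℤ : ℝ) := by exact_mod_cast W.conductorNorm_pos_holds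
  have := mul_le_mul_of_nonneg_right hKK' (Real.log_nonneg hN1)
  linarith [hC W]

/-- Monotonicity of the POLY-abc shape in the exponent (`rad ≥ 1`). [folklore] -/
theorem polyAbcWith_mono {M M' : ℝ} (hMM' : M ≤ M') (h : PolyAbcWith M) : PolyAbcWith M' := by
  obtain ⟨C, hC⟩ := h
  refine ⟨max C 0, fun a b c habc => ?_⟩
  have hR1 : (1 : ℝ) ≤ ((rad a b c : ℕ) : ℝ) := by
    rw [rad_def]; exact_mod_cast Nat.succ_le_of_lt (Nat.radical_pos _)
  calc (c : ℝ) ≤ C * ((rad a b c : ℕ) : ℝ) ^ M := hC a b c habc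
    _ ≤ max C 0 * ((rad a b c : ℕ) : ℝ) ^ M :=
        mul_le_mul_of_nonneg_right (le_max_left _ _) (Real.rpow_nonneg (by linarith) _)
    _ ≤ max C 0 * ((rad a b c : ℕ) : ℝ) ^ M' :=
        mul_le_mul_of_nonneg_left (Real.rpow_le_rpow_of_exponent_le hR1 hMM') (le_max_right _ _)

/-- **POLY-SZPIRO(K) ⟹ POLY-abc(K/5)** for `K ≥ 0` (Oesterlé 1988, §2 Remarque (Szpiro) / §3 with a
general exponent): apply the Szpiro-type bound to the global minimal `2`-isogenous Frey model `W₀` of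
the tree's `exists_minimal_isog_model` (`N ∣ 2¹² rad(abc)`, `c⁵ ≤ 2⁹ |Δ_min|`):
`5 log c ≤ 9 log 2 + K log(2¹² rad) + C`, i.e. `c ≤ e^{(C + 9 log 2 + 12 K log 2)/5} · rad^{K/5}`.
At `K = 6 + 5ε` this is the tree's `abc_sixFifths_of_szpiro_holds`. «NOT abc» for every fixed `K`
(POLY-abc(M) is abc only in the limit `M → 1⁺`). [cite: Oesterle1988, §2 Remarque (Szpiro), p. 168] -/
theorem polyAbcWith_of_polySzpiroWith {K : ℝ} (hK : 0 ≤ K) (h : PolySzpiroWith K) :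
    PolyAbcWith (K / 5) := by
  obtain ⟨C, hC⟩ := h
  refine ⟨Real.exp ((C + 9 * Real.log 2 + 12 * K * Real.log 2) / 5), fun a b c habc => ?_⟩
  obtain ⟨W₀, hE, hmin, hN, hc5⟩ := exists_minimal_isog_model habc
  haveI := hE
  have key := hC (W₀.baseChange ℚ)
  rw [minimalDiscriminantNorm_eq_natAbs_holds W₀ (Δ_ne_zero_of_isElliptic_baseChange_int W₀) hmin]
    at key
  -- positivity facts
  have hc0 : 0 < c := by obtain ⟨ha, hb, hsum, -⟩ := habc; omega
  have hcR : (0 : ℝ) < (c : ℝ) := by exact_mod_cast hc0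
  have hradpos : 0 < rad a b c := by rw [rad_def]; exact Nat.radical_pos _
  have hR0 : (0 : ℝ) < ((rad a b c : ℕ) : ℝ) := by exact_mod_cast hradpos
  have hNpos : 0 < (W₀.baseChange ℚ).conductorNorm ℤ := (W₀.baseChange ℚ).conductorNorm_pos_holds
  have hNR : (0 : ℝ) < (((W₀.baseChange ℚ).conductorNorm ℤ : ℕ) : ℝ) := by exact_mod_cast hNpos
  have hΔpos : (0 : ℝ) < ((W₀.Δ.natAbs : ℕ) : ℝ) := by
    have : W₀.Δ ≠ 0 := Δ_ne_zero_of_isElliptic_baseChange_int W₀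
    exact_mod_cast Int.natAbs_pos.mpr this
  -- `N ≤ 2¹² rad`, hence `log N ≤ 12 log 2 + log rad`
  have hNle : (((W₀.baseChange ℚ).conductorNorm ℤ : ℕ) : ℝ) ≤ 2 ^ 12 * ((rad a b c : ℕ) : ℝ) := by
    have := Nat.le_of_dvd (mul_pos (by positivity) hradpos) hN
    exact_mod_cast this
  have hlogN : Real.log (((W₀.baseChange ℚ).conductorNorm ℤ : ℕ) : ℝ) ≤
      12 * Real.log 2 + Real.log ((rad a b c : ℕ) : ℝ) := by
    have h1 := Real.log_le_log hNR hNle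
    rw [Real.log_mul (by positivity) hR0.ne', Real.log_pow] at h1
    push_cast at h1
    linarith
  -- `c⁵ ≤ 512 |Δ|`, hence `5 log c ≤ 9 log 2 + log |Δ|`
  have hlogc : 5 * Real.log (c : ℝ) ≤ 9 * Real.log 2 + Real.log ((W₀.Δ.natAbs : ℕ) : ℝ) := by
    have h1 : ((c : ℝ)) ^ 5 ≤ 512 * ((W₀.Δ.natAbs : ℕ) : ℝ) := by
      have : ((c : ℤ) ^ 5 : ℤ) ≤ 512 * (W₀.Δ.natAbs : ℤ) := by
        rw [Int.natCast_natAbs]; exact hc5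
      exact_mod_cast this
    have h2 := Real.log_le_log (by positivity) h1
    rw [Real.log_pow, Real.log_mul (by norm_num) hΔpos.ne',
      show (512 : ℝ) = 2 ^ 9 by norm_num, Real.log_pow] at h2
    push_cast at h2
    linarith
  -- combine with the Szpiro-type bound `log |Δ| ≤ K log N + C`
  have hKlog : K * Real.log (((W₀.baseChange ℚ).conductorNorm ℤ : ℕ) : ℝ) ≤
      K * (12 * Real.log 2 + Real.log ((rad a b c : ℕ) : ℝ)) :=
    mul_le_mul_of_nonneg_left hlogN hK
  have hmain : Real.log (c : ℝ) ≤
      (C + 9 * Real.log 2 + 12 * K * Real.log 2) / 5 + K / 5 * Real.log ((rad a b c : ℕ) : ℝ) := by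
    have : 5 * Real.log (c : ℝ) ≤ C + 9 * Real.log 2 + 12 * K * Real.log 2 +
        K * Real.log ((rad a b c : ℕ) : ℝ) := by linarith
    linarith
  have h3 := Real.exp_le_exp.mpr hmain
  rw [Real.exp_log hcR, Real.exp_add,
    show K / 5 * Real.log ((rad a b c : ℕ) : ℝ) = Real.log ((rad a b c : ℕ) : ℝ) * (K / 5) by ring,
    ← Real.rpow_def_of_pos hR0] at h3
  exact h3

/-- **Row CF-2 in the abc currency, kernel only:** `R_KSλ ⟹ POLY-abc((6 + λ)/5)` for `λ ≥ −6`
(`polySzpiroWith_of_rksPolar` then Oesterlé's step). The sharper paper value `1 + λ/6 + ε` goes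
through `|c₄|³` (`genPolySzpiroWith_of_rksPolar`) and a Frey-curve `c₄` estimate not in the kernel.
«NOT abc — POLY-abc((6 + λ)/5)». [folklore] -/
theorem polyAbcWith_of_rksPolar' {lam : ℝ} (hlam : -6 ≤ lam) (h : RKSPolar lam) :
    PolyAbcWith ((6 + lam) / 5) :=
  polyAbcWith_of_polySzpiroWith (by linarith) (polySzpiroWith_of_rksPolar h)

/-- **POLY-SZPIRO (rung A-PS, by name) ⟹ POLY-abc for SOME exponent.** [folklore] -/
theorem exists_polyAbcWith_of_polySzpiroRat (h : Summit.ABC.PolySzpiroRat) : ∃ M : ℝ, PolyAbcWith M := by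
  obtain ⟨K, C, hKC⟩ := h
  have h0 : PolySzpiroWith (max K 0) := polySzpiroWith_mono (le_max_left _ _) ⟨C, hKC⟩
  exact ⟨max K 0 / 5, polyAbcWith_of_polySzpiroWith (le_max_right _ _) h0⟩

/-- **POLY-abc(M) ⟹ the polynomial Baker shape `BakerShapeBound 0 1`** (`log c ≤ κ log rad(abc)`):
`log c ≤ log C + M log rad ≤ (M + log⁺C / log 2) · log rad`, using `rad(abc) ≥ 2` for every abc
triple (`c ≥ 2`); any real `M`. [folklore] -/
theorem bakerShapeBound_zero_one_of_polyAbcWith {M : ℝ} (h : PolyAbcWith M) :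
    BakerShapeBound 0 1 := by
  obtain ⟨C, hC⟩ := h
  refine ⟨M + max (Real.log C) 0 / Real.log 2, fun a b c habc => ?_⟩
  have hlog2 : 0 < Real.log 2 := Real.log_pos one_lt_two
  obtain ⟨ha, hb, hsum, hcop⟩ := habc
  have hc2 : 2 ≤ c := by omega
  have hcR : (0 : ℝ) < (c : ℝ) := by exact_mod_cast (show 0 < c by omega)
  -- `rad(abc) ≥ 2`: `abc ≥ 2` has a prime factor
  have hrad2 : 2 ≤ rad a b c := by
    rw [rad_def]
    have hab : 1 ≤ a * b := Nat.one_le_iff_ne_zero.mpr (by positivity)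
    exact Nat.two_le_radical_iff.mpr (by nlinarith)
  have hR2 : (2 : ℝ) ≤ ((rad a b c : ℕ) : ℝ) := by exact_mod_cast hrad2
  have hR0 : (0 : ℝ) < ((rad a b c : ℕ) : ℝ) := by linarith
  have hlogR : Real.log 2 ≤ Real.log ((rad a b c : ℕ) : ℝ) := Real.log_le_log two_pos hR2
  have hlogR0 : 0 < Real.log ((rad a b c : ℕ) : ℝ) := hlog2.trans_le hlogR
  have h1 := hC a b c ⟨ha, hb, hsum, hcop⟩
  -- `C > 0` necessarily (`c > 0`)
  have hCpos : 0 < C := by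
    by_contra hle
    have : C * ((rad a b c : ℕ) : ℝ) ^ M ≤ 0 :=
      mul_nonpos_of_nonpos_of_nonneg (not_lt.mp hle) (Real.rpow_nonneg hR0.le _)
    linarith
  have h2 := Real.log_le_log hcR h1
  rw [Real.log_mul hCpos.ne' (Real.rpow_pos_of_pos hR0 _).ne', Real.log_rpow hR0] at h2
  -- absorb `log C` into the slope
  have h3 : Real.log C ≤ max (Real.log C) 0 / Real.log 2 * Real.log ((rad a b c : ℕ) : ℝ) := by
    have hm : Real.log C ≤ max (Real.log C) 0 := le_max_left _ _
    have hm0 : 0 ≤ max (Real.log C) 0 := le_max_right _ _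
    have : max (Real.log C) 0 ≤ max (Real.log C) 0 / Real.log 2 * Real.log ((rad a b c : ℕ) : ℝ) := by
      rw [div_mul_eq_mul_div, le_div_iff₀ hlog2]
      exact mul_le_mul_of_nonneg_left hlogR hm0
    linarith
  simp only [Real.rpow_zero, mul_one, pow_one]
  nlinarith

/-- **F29 — rung A-PS ⟹ polynomial Baker shape:** `Summit.ABC.PolySzpiroRat ⟹ BakerShapeBound 0 1`.
Both are «NOT abc»; this only places A-PS inside the A1 cell's `(θ, m)`-indexed family at
`(0, 1)` (polynomial), strictly below the proved Stewart–Yu shape `(1/3, 3)` in strength of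
conclusion demanded. [folklore] -/
theorem bakerShapeBound_zero_one_of_polySzpiroRat (h : Summit.ABC.PolySzpiroRat) :
    BakerShapeBound 0 1 := by
  obtain ⟨K, C, hKC⟩ := h
  have h0 : PolySzpiroWith (max K 0) := polySzpiroWith_mono (le_max_left _ _) ⟨C, hKC⟩
  exact bakerShapeBound_zero_one_of_polyAbcWith (polyAbcWith_of_polySzpiroWith (le_max_right _ _) h0)

/-- And from the sheet's chain (a) requirement: `R_KSλ ⟹ BakerShapeBound 0 1` (`λ ≥ −6`).
[folklore] -/
theorem bakerShapeBound_zero_one_of_rksPolar {lam : ℝ} (hlam : -6 ≤ lam) (h : RKSPolar lam) :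
    BakerShapeBound 0 1 :=
  bakerShapeBound_zero_one_of_polyAbcWith (polyAbcWith_of_rksPolar' hlam h)

end Summit.ABC.FunctionField

end
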